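import Mathlib
import Literature.MathematicalPhysics.QuantumFieldTheory.MirrorRPHalfPlaneContinuation
import Summits.QuantumFields.YangMills.Theorems.F4SubCurvatureDoorShortRootRigiditySliceInClass
import HarnessLib

/-!
# Rung R0 «PlanarFrameTimeHolomorphy» of LINE g20-A «angular type» (planner ym-idea-3 g20, crux ⟨stmt-QuantumFields-23035⟩
# `F4SubCurvatureDoor.ShortRootRigidity`; owner file `Cruxes/ShortRootRigidity/Lines/angular_type_rungs.lean`, critic N1 «S1 first»)

Free-hands work of the LEAD seat ym-line-sfw-p2 (gen 74).  The first lemma of the plan for the load-bearing stub (C)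
`PlanarSpectralCone`: COMPLEX TRANSLATION ALONG THE FRAME-`0` TIME AXIS.  For a kernel `k` of the hexagonal planar class
(`InPlanarClass`: continuous off `0`, bounded outside the unit disc, `D₆`-invariant, reflection positive across `y₀ = 0`) and a
point `y` off the mirror `y₀ = 0`, the function `u ↦ k(y₀ + u, y₁)` is on `(−|y₀|, |y₀|)` the trace of a function holomorphic on
the disc `|u| < |y₀|`, bounded by the axis value `k(y₀ + Re u, 0)`.

Proof = the tree's one-mirror theorem `IsMirrorRPKernel.exists_halfPlane_continuation`
(`Literature/…/MirrorRPHalfPlaneContinuation.lean`: polarisation + measure-free Bernstein–Widder) for the mirror `e₀^⊥` of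
`ℝ²`: the planar class is mirror-RP for `e₀` (its RP conjunct, evenness, and `(ℝ∙e₀)ᗮ.reflection = timeReflection 2`), bounded on
closed half-spaces `{y₀ ≥ t₀ > 0}` (compactness inside the unit disc + the class bound outside), so `t ↦ k(t e₀ + y₁e₁)` continues to
`{Re t > 0}` with `‖F t‖ ≤ k((Re t) e₀)`; the disc `|u| < |y₀|` around `y₀ > 0` maps into that half-plane by `u ↦ y₀ + u`, and for
`y₀ < 0` by `u ↦ −y₀ − u` together with the time-reflection invariance of `k`.

The Prop `PlanarFrameTimeHolomorphy` (and `mk2`) are restated CHARACTER-FOR-CHARACTER from the owner file (same namespace).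
HONEST LABEL: a budget-free first rung toward the XL stub (C); (C), (A) and the crux are untouched; no crux, rung of LADDER-YM,
leaf or summit is proved; the Yang–Mills mass gap is NOT proved by this.
-/

noncomputable section

namespace Summit.QuantumFields.YangMills.Cruxes.ShortRootRigidity.AngularTypeRungs

open scoped Topology InnerProductSpace BigOperators
open Set Metric
open Literature.MathematicalPhysics.QuantumLattice (timeReflection timeReflection_apply)
open Literature.MathematicalPhysics.QuantumFieldTheory (IsMirrorRPKernel isMirrorRPKernel_neg_arg_iff)
open Summit.QuantumFields.YangMills.Theorems.F4SubCurvatureDoorSliceDensityRegistered (E2)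
open Summit.QuantumFields.YangMills.Theorems.F4SubCurvatureDoorSliceInClassRegistered (InPlanarClass)

/-- The point `(a, b)` of the plane (same text as `Lines/angular_type.lean`'s `mk2`). [problem-side definition] -/
def mk2 (a b : ℝ) : E2 := (WithLp.equiv 2 (Fin 2 → ℝ)).symm ![a, b]

/-- **R0 · PlanarFrameTimeHolomorphy** (target, S–M; budget-free).  Complex translation along the frame-`0` time axis:
for `k ∈ InPlanarClass` and `y` off the mirror `y₀ = 0`, `u ↦ k(y₀ + u, y₁)` extends holomorphically to the disc
`|u| < |y₀|`, with the axis bound `‖g(w)‖ ≤ k(y₀ + Re w, 0)` (OS contraction semigroup + Cauchy–Schwarz; for `y₀ < 0` use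
the time reflection in `D₆`).  Frames `±60°` follow by `D₆`-invariance.
[target; sources: OsterwalderSchrader1973 §4, GlimmJaffe1987 Thm. 6.1.3; tree: MirrorSlabTranslationHolomorphy] -/
def PlanarFrameTimeHolomorphy : Prop :=
  ∀ k : E2 → ℝ, InPlanarClass k → ∀ y : E2, y 0 ≠ 0 →
    ∃ g : ℂ → ℂ, DifferentiableOn ℂ g (Metric.ball (0 : ℂ) |y 0|) ∧
      (∀ u : ℝ, |u| < |y 0| → g u = k (mk2 (y 0 + u) (y 1))) ∧
      ∀ w ∈ Metric.ball (0 : ℂ) |y 0|, ‖g w‖ ≤ k (mk2 (y 0 + w.re) 0)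

/-! ## Planar bookkeeping: `mk2`, the time axis `e₀`, the mirror reflection -/

/-- First coordinate of `mk2`. -/
@[simp] theorem mk2_apply_zero (a b : ℝ) : mk2 a b 0 = a := by simp [mk2]

/-- Second coordinate of `mk2`. -/
@[simp] theorem mk2_apply_one (a b : ℝ) : mk2 a b 1 = b := by simp [mk2]

/-- `t • e₀ + (0, b) = (t, b)`. -/
theorem smul_single_add_mk2 (t b : ℝ) :
    t • (EuclideanSpace.single 0 (1 : ℝ) : E2) + mk2 0 b = mk2 t b := by
  ext i
  fin_cases i <;> simp [mk2]

/-- `t • e₀ = (t, 0)`. -/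
theorem smul_single_eq_mk2 (t : ℝ) : t • (EuclideanSpace.single 0 (1 : ℝ) : E2) = mk2 t 0 := by
  ext i
  fin_cases i <;> simp [mk2]

/-- Time reflection flips the first coordinate of `mk2`. -/
theorem timeReflection_mk2 (a b : ℝ) : timeReflection 2 (mk2 a b) = mk2 (-a) b := by
  ext i
  fin_cases i <;> simp [timeReflection_apply, mk2]

/-- The reflection in the mirror `e₀^⊥` of `ℝ²` flips the coordinate `0`. -/
theorem reflection_single_zero_apply (x : E2) (i : Fin 2) :
    ((ℝ ∙ (EuclideanSpace.single 0 (1 : ℝ) : E2))ᗮ.reflection x) i = if i = 0 then -x i else x i := by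
  set e : E2 := EuclideanSpace.single 0 (1 : ℝ) with he
  have hdec : x = x 0 • e + (x - x 0 • e) := by abel
  have hperp : x - x 0 • e ∈ (ℝ ∙ e)ᗮ := by
    rw [Submodule.mem_orthogonal_singleton_iff_inner_right]
    rw [inner_sub_right, inner_smul_right, he, EuclideanSpace.inner_single_left, EuclideanSpace.inner_single_left]
    simp
  have h1 : (ℝ ∙ e)ᗮ.reflection e = -e := Submodule.reflection_orthogonalComplement_singleton_eq_neg e
  have h2 : (ℝ ∙ e)ᗮ.reflection (x - x 0 • e) = x - x 0 • e := Submodule.reflection_mem_subspace_eq_self hperp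
  calc ((ℝ ∙ e)ᗮ.reflection x) i = ((ℝ ∙ e)ᗮ.reflection (x 0 • e + (x - x 0 • e))) i := by rw [← hdec]
    _ = (x 0 • (ℝ ∙ e)ᗮ.reflection e + (ℝ ∙ e)ᗮ.reflection (x - x 0 • e)) i := by rw [map_add, map_smul]
    _ = (x 0 • (-e) + (x - x 0 • e)) i := by rw [h1, h2]
    _ = if i = 0 then -x i else x i := by
      rw [he]
      by_cases hi : i = 0
      · subst hi; simp
      · simp [hi]

/-- The mirror reflection of `e₀^⊥` IS the time reflection of `ℝ²`. -/
theorem reflection_single_zero_eq_timeReflection (x : E2) :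
    (ℝ ∙ (EuclideanSpace.single 0 (1 : ℝ) : E2))ᗮ.reflection x = timeReflection 2 x := by
  ext i
  rw [reflection_single_zero_apply, timeReflection_apply]

/-- `⟪x, e₀⟫ = x 0`. -/
theorem inner_single_zero (x : E2) : ⟪x, (EuclideanSpace.single 0 (1 : ℝ) : E2)⟫_ℝ = x 0 := by
  rw [EuclideanSpace.inner_single_right]; simp

/-! ## The planar class is mirror-RP for `e₀`, bounded on closed half-spaces -/

variable {k : E2 → ℝ}

/-- Reflection positivity across `y₀ = 0` (the class conjunct) is `IsMirrorRPKernel e₀ k`. -/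
theorem isMirrorRPKernel_of_inPlanarClass (hk : InPlanarClass k) :
    IsMirrorRPKernel (EuclideanSpace.single 0 (1 : ℝ) : E2) k := by
  have heven : (fun x => k (-x)) = k := funext hk.2.2.2.2.1
  have h : IsMirrorRPKernel (EuclideanSpace.single 0 (1 : ℝ) : E2) (fun x => k (-x)) := by
    refine (isMirrorRPKernel_neg_arg_iff _ k).2 fun m p c hp => ?_
    have hp' : ∀ i, 0 < p i 0 := fun i => by simpa [inner_single_zero] using hp i
    have := hk.2.2.2.2.2.1 m p c hp'
    simpa only [reflection_single_zero_eq_timeReflection] using this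
  rwa [heven] at h

/-- Bounded on every closed half-space `{y₀ ≥ t₀}` (`t₀ > 0`): compactness inside the unit disc, the class bound outside. -/
theorem slab_bound_of_inPlanarClass (hk : InPlanarClass k) (t₀ : ℝ) (ht₀ : 0 < t₀) :
    ∃ M : ℝ, ∀ x : E2,
      t₀ ≤ ⟪x, ‖(EuclideanSpace.single 0 (1 : ℝ) : E2)‖⁻¹ • (EuclideanSpace.single 0 (1 : ℝ) : E2)⟫_ℝ → |k x| ≤ M := by
  obtain ⟨C, hC⟩ := hk.2.1
  set A : Set E2 := {x | t₀ ≤ x 0} ∩ Metric.closedBall 0 1 with hA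
  have hAc : IsCompact A :=
    (isCompact_closedBall (0 : E2) 1).of_isClosed_subset
      ((isClosed_le continuous_const (PiLp.continuous_apply 2 (fun _ : Fin 2 => ℝ) 0)).inter Metric.isClosed_closedBall)
      Set.inter_subset_right
  have hA0 : A ⊆ {x | x ≠ 0} := by
    intro x hx h0
    have h1 : t₀ ≤ x 0 := hx.1
    rw [h0] at h1
    simp at h1
    linarith
  obtain ⟨M₁, hM₁⟩ := hAc.exists_bound_of_continuousOn (hk.1.mono hA0)
  refine ⟨max M₁ C, fun x hx => ?_⟩
  have hn1 : ‖(EuclideanSpace.single 0 (1 : ℝ) : E2)‖ = 1 := by simp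
  rw [hn1, inv_one, one_smul, inner_single_zero] at hx
  by_cases h1 : ‖x‖ ≤ 1
  · have hxA : x ∈ A := ⟨hx, by rwa [Metric.mem_closedBall, dist_zero_right]⟩
    have := hM₁ x hxA
    rw [Real.norm_eq_abs] at this
    exact this.trans (le_max_left _ _)
  · exact (hC x (le_of_not_ge h1)).trans (le_max_right _ _)

/-- The one-mirror continuation for the planar class: `t ↦ k(t, b)` (`t > 0`) continues to `{Re t > 0}` with the axis bound. -/
theorem halfPlane_continuation_of_inPlanarClass (hk : InPlanarClass k) (b : ℝ) :
    ∃ F : ℂ → ℂ, DifferentiableOn ℂ F {t : ℂ | 0 < t.re} ∧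
      (∀ t : ℝ, 0 < t → F t = ((k (mk2 t b) : ℝ) : ℂ)) ∧
      (∀ t : ℂ, 0 < t.re → ‖F t‖ ≤ k (mk2 t.re 0)) := by
  set e : E2 := EuclideanSpace.single 0 (1 : ℝ) with he
  have hn1 : ‖e‖ = 1 := by simp [he]
  have hn : e ≠ 0 := by
    intro h; rw [h, norm_zero] at hn1; exact zero_ne_one hn1
  have hK' : ContinuousOn k ({0}ᶜ : Set E2) := by
    convert hk.1 using 1
    ext y; simp
  have heven : ∀ x, k (-x) = k x := hk.2.2.2.2.1
  have hinv : ∀ x, k ((ℝ ∙ e)ᗮ.reflection x) = k x := fun x => by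
    rw [he, reflection_single_zero_eq_timeReflection]; exact hk.2.2.1 x
  have hv : ⟪mk2 0 b, e⟫_ℝ = 0 := by rw [he, inner_single_zero, mk2_apply_zero]
  obtain ⟨F, hFd, hFr, hFb⟩ :=
    IsMirrorRPKernel.exists_halfPlane_continuation hn hK' heven (slab_bound_of_inPlanarClass hk) hinv
      (isMirrorRPKernel_of_inPlanarClass hk) hv
  refine ⟨F, hFd, fun t ht => ?_, fun t ht => ?_⟩
  · rw [hFr t ht, hn1, inv_one, one_smul, he, smul_single_add_mk2]
  · have := hFb t ht
    rwa [hn1, inv_one, one_smul, he, smul_single_eq_mk2] at this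

/-! ## The rung -/

/-- ★ **R0 `PlanarFrameTimeHolomorphy`** (the owner's Prop BY NAME): complex translation along the frame-`0` time axis. -/
theorem planarFrameTimeHolomorphy : PlanarFrameTimeHolomorphy := by
  intro k hk y hy0
  obtain ⟨F, hFd, hFr, hFb⟩ := halfPlane_continuation_of_inPlanarClass hk (y 1)
  have htr : ∀ a b : ℝ, k (mk2 (-a) b) = k (mk2 a b) := fun a b => by
    rw [← timeReflection_mk2]; exact hk.2.2.1 _
  rcases lt_or_gt_of_ne hy0 with hneg | hpos
  · -- `y₀ < 0`: reflect in time, `g w := F (−y₀ − w)`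
    have habs : |y 0| = -y 0 := abs_of_neg hneg
    refine ⟨fun w => F (((-y 0 : ℝ) : ℂ) - w), ?_, ?_, ?_⟩
    · have hmaps : MapsTo (fun w : ℂ => ((-y 0 : ℝ) : ℂ) - w) (ball (0 : ℂ) |y 0|) {t : ℂ | 0 < t.re} := by
        intro w hw
        rw [mem_ball_zero_iff] at hw
        have : |w.re| < |y 0| := lt_of_le_of_lt (Complex.abs_re_le_norm w) hw
        rw [habs] at this
        simp only [mem_setOf_eq, Complex.sub_re, Complex.ofReal_re]
        linarith [neg_abs_le w.re, (abs_lt.1 this).2]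
      exact hFd.comp ((differentiable_const _).sub differentiable_id).differentiableOn hmaps
    · intro u hu
      rw [habs] at hu
      have hpos' : 0 < -y 0 - u := by linarith [(abs_lt.1 hu).2]
      have : (((-y 0 : ℝ) : ℂ) - (u : ℂ)) = (((-y 0 - u : ℝ)) : ℂ) := by push_cast; ring
      simp only [this, hFr _ hpos']
      rw [show -y 0 - u = -(y 0 + u) by ring, htr]
    · intro w hw
      rw [mem_ball_zero_iff, habs] at hw
      have hre : 0 < (((-y 0 : ℝ) : ℂ) - w).re := by
        have : |w.re| < -y 0 := lt_of_le_of_lt (Complex.abs_re_le_norm w) hw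
        simp only [Complex.sub_re, Complex.ofReal_re]
        linarith [(abs_lt.1 this).2]
      have hb := hFb _ hre
      simp only [Complex.sub_re, Complex.ofReal_re] at hb
      rw [show -y 0 - w.re = -(y 0 + w.re) by ring, htr] at hb
      exact hb
  · -- `y₀ > 0`: `g w := F (y₀ + w)`
    have habs : |y 0| = y 0 := abs_of_pos hpos
    refine ⟨fun w => F (((y 0 : ℝ) : ℂ) + w), ?_, ?_, ?_⟩
    · have hmaps : MapsTo (fun w : ℂ => ((y 0 : ℝ) : ℂ) + w) (ball (0 : ℂ) |y 0|) {t : ℂ | 0 < t.re} := by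
        intro w hw
        rw [mem_ball_zero_iff] at hw
        have : |w.re| < |y 0| := lt_of_le_of_lt (Complex.abs_re_le_norm w) hw
        rw [habs] at this
        simp only [mem_setOf_eq, Complex.add_re, Complex.ofReal_re]
        linarith [(abs_lt.1 this).1]
      exact hFd.comp ((differentiable_const _).add differentiable_id).differentiableOn hmaps
    · intro u hu
      rw [habs] at hu
      have hpos' : 0 < y 0 + u := by linarith [(abs_lt.1 hu).1]
      have : (((y 0 : ℝ) : ℂ) + (u : ℂ)) = (((y 0 + u : ℝ)) : ℂ) := by push_cast; ring
      simp only [this, hFr _ hpos']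
    · intro w hw
      rw [mem_ball_zero_iff, habs] at hw
      have hre : 0 < (((y 0 : ℝ) : ℂ) + w).re := by
        have : |w.re| < y 0 := lt_of_le_of_lt (Complex.abs_re_le_norm w) hw
        simp only [Complex.add_re, Complex.ofReal_re]
        linarith [(abs_lt.1 this).1]
      have hb := hFb _ hre
      simp only [Complex.add_re, Complex.ofReal_re] at hb
      exact hb

end Summit.QuantumFields.YangMills.Cruxes.ShortRootRigidity.AngularTypeRungs

end
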